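import Mathlib
import HarnessLib
import Summits.Ventures.LatticeQCDFlow.Exactness.FlowPushforward
import Summits.Ventures.LatticeQCDFlow.Exactness.InvariantComposition
import Summits.Ventures.LatticeQCDFlow.Exactness.RefreshScan

/-!
# Field-transformed MCMC is exact: an exact update conjugated by a change of variables (HMC in trivializing-map variables)

HONEST FRAMING: exact (Metropolis-corrected) sampling algorithms for lattice gauge theory;
figures of merit are autocorrelation/cost numbers at stated couplings and volumes; no
continuum-physics claim.

Venture `LatticeQCDFlow` (cell pub-lqcd), topic `Exactness`; FANOUT row 7 (`s0-cpn-null`: the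
S0-D1 rung — 2D CP⁹, the leading-order trivializing map used INSIDE the HMC algorithm versus plain
HMC at equal cost, the Engel–Schaefer 2011 null test).  NEW WORK of the cell over Mathlib
(`ProbabilityTheory.Kernel.Invariant` / `Kernel.IsReversible`, `Kernel.map` / `Kernel.comap`,
`MeasurableEquiv`) and the tree's `Exactness/FlowPushforward.lean` (`HasJacobian`) and
`Exactness/InvariantComposition.lean` (`nHit`) / `Exactness/RefreshScan.lean` (`invariant_smul`);
nothing here is cited as a fact.  Printed
counterparts, named only: Lüscher 2010 §2.3–§2.4 (the HMC algorithm simulated in new variables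
`V`, `U = 𝓕(V)`, with the modified action `S̃(V) = S(𝓕(V)) − ln det 𝓕_*(V)`, "generates `U`
distributed with `e^{−S(U)}`"), Engel–Schaefer 2011 §2 (the same for the CP(N−1) model, "THMC"),
Duane–Kennedy–Pendleton–Roweth 1987 (HMC).

## Content (`κ : Kernel Ω Ω` an update of the `V`-variables, `F : Ω ≃ᵐ Ω'` the field
transformation, `ν` a measure on `Ω`)

* `conjKernel κ F : Kernel Ω' Ω'` — the update `κ` REPORTED in the variables `x = F v`: from `x`
  pull back to `F⁻¹ x`, make one `κ`-move, push the new point through `F`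
  (`conjKernel_apply : conjKernel κ F x = F_* κ(F⁻¹ x)`, `conjKernel_apply'`); Markov if `κ` is.
  This is what a THMC code does every trajectory (it stores `V`, it measures on `U = 𝓕(V)`).
* **`invariant_conjKernel`** — if `κ` leaves `ν` invariant then `conjKernel κ F` leaves `F_* ν`
  invariant; **`isReversible_conjKernel`** — detailed balance transfers the same way.  No property
  of `F` beyond measurable bijectivity is used.
* `conjKernel_id`, **`conjKernel_comp`**, `conjKernel_nHit` — reporting commutes with composing:
  `n` reported moves = the reported `n`-fold move, so the whole `U`-history is the image under `F`
  of the `V`-history; `conjKernel_conjKernel`, `conjKernel_symm_conjKernel` — transformations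
  compose and undo (the `U`-chain and the `V`-chain are one Markov chain in two coordinate systems).
* `lintegral_conjKernel`, `integral_conjKernel`, **`correlation_conjKernel(_nHit)`** — the
  observable dictionary: the stationary lag-`n` correlation `∫ O · (Kⁿ O) d(F_*ν)` of an observable
  `O` under the reported chain equals that of `O ∘ F` under the `V`-chain (and `∫ O d(F_*ν) =
  ∫ O∘F dν` is Mathlib's `integral_map_equiv`).  So "the autocorrelation time of `Q` in THMC" is,
  by definition, the autocorrelation time of `Q ∘ 𝓕` in the HMC chain for `S̃` — the comparison
  row 7 measures is between two HMC chains for two actions, `S` and `S̃`, read through `𝓕`.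
* **`transformedUpdate_invariant` / `transformedUpdate_isReversible`** (with `HasJacobian vol F J`
  of `FlowPushforward.lean`): if `κ` is exact (resp. reversible) for the PULLED-BACK weight
  `((p ∘ F) · J) · vol` then the reported update is exact (resp. reversible) for `p · vol` —
  because `F_* (((p ∘ F) · J) · vol) = p · vol` is `HasJacobian.map_withDensity`;
  `integral_comp_transformed` — and `∫ O d(p·vol) = ∫ (O∘F) d(((p∘F)·J)·vol)` (expectations).
* `exp_neg_transformedAction` — Lüscher's modified action `S̃ = S ∘ F − log J` has
  `e^{−S̃} = (e^{−S} ∘ F) · J` (`J > 0`); **`thmc_exact`** — hence ANY update that is exact for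
  `e^{−S̃(V)} · vol` (HMC with any reversible volume-preserving integrator and accept/reject step —
  the tree's `InvolutiveMetropolis.involMH_invariant`, `Phi4HMCExact.hmc_exact_of_involutive` —
  or local Metropolis, heat bath, …), reported through `F`, is exact for `e^{−S(U)} · vol`
  (`thmc_isReversible`: and reversible if the `V`-update is); `thmc_exact_smul` — and for every
  scalar multiple (the normalised Boltzmann law `𝒵⁻¹e^{−S}·vol`).
* `thmc_wilson_exact` — the lattice-gauge specialisation: `Ω = G^E` (`GaugeConfig d L G`),
  `vol = ⊗_e Haar`, target = the tree's `wilsonWeight ρ β = e^{−β S_W} · ⊗_e Haar`.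

Dictionary for row 7 (2D CP(N−1), Engel–Schaefer 2011): `Ω = Ω'` = the product of the site spheres
`S^{2N−1}` and the link circles `U(1)` with the product of the normalised invariant measures as
`vol`; `S` = the quartic-free auxiliary-gauge-field action `−Nβ Σ_{x,μ} (z̄_{x+μ} λ_{x,μ} z_x + c.c.)`;
`F = 𝓕_{t}` = the time-`t` map of the gradient flow of `S` (the leading-order trivializing map,
one zero-parameter "layer"), `J = det 𝓕_*` from Lüscher's formula `ln det 𝓕_* = ∫₀ᵗ div Z ds`;
`κ` = one HMC trajectory + accept/reject for `S̃`.  Exactness of THMC is then `thmc_exact`; what the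
map may change is only the autocorrelation of `O ∘ 𝓕_t` versus that of `O` — the figure of merit
of the rung, on which nothing is claimed here.

Not here: the construction of `J` for the gradient flow on a product of compact manifolds (the
Jacobian formula is the tree's `TrivializingMaps/JacobianFormula.lean` for `SU(n)^E`), HMC itself
on a group manifold, ergodicity, and anything quantitative about autocorrelations.
-/

namespace Summit.Ventures.LatticeQCDFlow.Exactness

open MeasureTheory ProbabilityTheory ProbabilityTheory.Kernel
open scoped ENNReal

variable {Ω Ω' Ω'' : Type*} [MeasurableSpace Ω] [MeasurableSpace Ω'] [MeasurableSpace Ω'']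

/-! ## The reported (conjugated) kernel -/

/-- **The update `κ` reported in the variables `x = F v`.**  From the current point `x : Ω'`, pull
back to `v = F⁻¹ x`, make one move of `κ` from `v`, and push the new point forward through `F`:
`conjKernel κ F x = F_* (κ (F⁻¹ x))`.  For Lüscher's THMC, `κ` is an HMC update for the modified
action `S̃` on the `V`-variables and `F = 𝓕` is the trivializing map. -/
noncomputable def conjKernel (κ : Kernel Ω Ω) (F : Ω ≃ᵐ Ω') : Kernel Ω' Ω' :=
  Kernel.comap (Kernel.map κ F) F.symm F.symm.measurable

/-- `conjKernel κ F x = F_* (κ (F⁻¹ x))`. -/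
theorem conjKernel_apply (κ : Kernel Ω Ω) (F : Ω ≃ᵐ Ω') (x : Ω') :
    conjKernel κ F x = (κ (F.symm x)).map F := by
  rw [conjKernel, Kernel.comap_apply, Kernel.map_apply _ F.measurable]

/-- On measurable sets: `conjKernel κ F x s = κ (F⁻¹ x) (F⁻¹' s)`. -/
theorem conjKernel_apply' (κ : Kernel Ω Ω) (F : Ω ≃ᵐ Ω') (x : Ω') {s : Set Ω'}
    (hs : MeasurableSet s) : conjKernel κ F x s = κ (F.symm x) (F ⁻¹' s) := by
  rw [conjKernel_apply, Measure.map_apply F.measurable hs]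

/-- The reported kernel of a Markov kernel is Markov. -/
instance conjKernel.isMarkovKernel (κ : Kernel Ω Ω) [IsMarkovKernel κ] (F : Ω ≃ᵐ Ω') :
    IsMarkovKernel (conjKernel κ F) := by
  haveI : IsMarkovKernel (Kernel.map κ F) := Kernel.IsMarkovKernel.map κ F.measurable
  unfold conjKernel
  infer_instance

/-- Integrals against the reported kernel: `∫⁻ g d(conjKernel κ F x) = ∫⁻ (g ∘ F) d(κ (F⁻¹ x))`. -/
theorem lintegral_conjKernel (κ : Kernel Ω Ω) (F : Ω ≃ᵐ Ω') (x : Ω') (g : Ω' → ℝ≥0∞) :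
    ∫⁻ y, g y ∂(conjKernel κ F x) = ∫⁻ w, g (F w) ∂(κ (F.symm x)) := by
  rw [conjKernel_apply, lintegral_map_equiv]

/-- Bochner version: `∫ g d(conjKernel κ F x) = ∫ (g ∘ F) d(κ (F⁻¹ x))` (the one-step conditional
expectation of an observable `g` of the reported chain is that of `g ∘ F` of the `V`-chain). -/
theorem integral_conjKernel {E : Type*} [NormedAddCommGroup E] [NormedSpace ℝ E]
    (κ : Kernel Ω Ω) (F : Ω ≃ᵐ Ω') (x : Ω') (g : Ω' → E) :
    ∫ y, g y ∂(conjKernel κ F x) = ∫ w, g (F w) ∂(κ (F.symm x)) := by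
  rw [conjKernel_apply, integral_map_equiv]

/-! ## Exactness and detailed balance transfer -/

/-- **Reported exact updates are exact.**  If `κ` leaves `ν` invariant, the update reported
through the measurable bijection `F` leaves `F_* ν` invariant.  (Pull the integral back along `F`,
use `F⁻¹ (F v) = v`, and recognise `(ν.bind κ) (F⁻¹' s) = ν (F⁻¹' s)`.) -/
theorem invariant_conjKernel {κ : Kernel Ω Ω} {ν : Measure Ω} (hκ : Invariant κ ν)
    (F : Ω ≃ᵐ Ω') : Invariant (conjKernel κ F) (ν.map F) := by
  change (ν.map F).bind ⇑(conjKernel κ F) = ν.map F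
  ext s hs
  rw [Measure.bind_apply hs (Kernel.aemeasurable _), lintegral_map_equiv,
    Measure.map_apply F.measurable hs]
  simp only [conjKernel_apply' _ _ _ hs, MeasurableEquiv.symm_apply_apply]
  rw [← Measure.bind_apply (F.measurable hs) (Kernel.aemeasurable _), hκ.def]

/-- Set integrals against `F_* ν` of a function of the reported kernel pull back along `F`. -/
theorem setLIntegral_map_equiv_conjKernel (κ : Kernel Ω Ω) (ν : Measure Ω) (F : Ω ≃ᵐ Ω')
    {A B : Set Ω'} (hB : MeasurableSet B) :
    ∫⁻ x in A, conjKernel κ F x B ∂(ν.map F) = ∫⁻ v in F ⁻¹' A, κ v (F ⁻¹' B) ∂ν := by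
  rw [MeasurableEquiv.restrict_map, lintegral_map_equiv]
  simp only [conjKernel_apply' _ _ _ hB, MeasurableEquiv.symm_apply_apply]

/-- **Detailed balance transfers.**  If `κ` is reversible with respect to `ν` (Mathlib's
`Kernel.IsReversible`: `∫_A κ(·, B) dν = ∫_B κ(·, A) dν`), the reported update is reversible with
respect to `F_* ν`: THMC inherits the reversibility of HMC. -/
theorem isReversible_conjKernel {κ : Kernel Ω Ω} {ν : Measure Ω} (hκ : IsReversible κ ν)
    (F : Ω ≃ᵐ Ω') : IsReversible (conjKernel κ F) (ν.map F) := by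
  intro A B hA hB
  rw [setLIntegral_map_equiv_conjKernel κ ν F hB, setLIntegral_map_equiv_conjKernel κ ν F hA]
  exact hκ (F.measurable hA) (F.measurable hB)

/-! ## Reporting commutes with composition -/

/-- Reporting the trivial update gives the trivial update. -/
@[simp] theorem conjKernel_id (F : Ω ≃ᵐ Ω') :
    conjKernel (Kernel.id : Kernel Ω Ω) F = Kernel.id := by
  ext x s hs
  rw [conjKernel_apply, Kernel.id_apply, Measure.map_dirac' F.measurable,
    MeasurableEquiv.apply_symm_apply, Kernel.id_apply]

/-- **`n` reported moves = the reported `n`-fold move**: `conjKernel (κ ∘ₖ η) F =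
conjKernel κ F ∘ₖ conjKernel η F`.  Hence the law of the whole reported history is the image of
the law of the `V`-history under `F` applied at every time. -/
theorem conjKernel_comp (κ η : Kernel Ω Ω) (F : Ω ≃ᵐ Ω') :
    conjKernel (κ ∘ₖ η) F = conjKernel κ F ∘ₖ conjKernel η F := by
  ext x s hs
  rw [conjKernel_apply' _ _ _ hs, Kernel.comp_apply' _ _ _ (F.measurable hs),
    Kernel.comp_apply' _ _ _ hs, lintegral_conjKernel]
  simp only [conjKernel_apply' _ _ _ hs, MeasurableEquiv.symm_apply_apply]

/-- Iterates: `conjKernel (nHit κ n) F = nHit (conjKernel κ F) n` (`nHit` of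
`InvariantComposition.lean` is the `n`-fold composition). -/
theorem conjKernel_nHit (κ : Kernel Ω Ω) (F : Ω ≃ᵐ Ω') :
    ∀ n, conjKernel (nHit κ n) F = nHit (conjKernel κ F) n
  | 0 => by rw [nHit_zero, nHit_zero, conjKernel_id]
  | n + 1 => by rw [nHit_succ, nHit_succ, conjKernel_comp, conjKernel_nHit κ F n]

/-- Transformations compose: reporting through `F` and then through `G` is reporting through
`G ∘ F`. -/
theorem conjKernel_conjKernel (κ : Kernel Ω Ω) (F : Ω ≃ᵐ Ω') (G : Ω' ≃ᵐ Ω'') :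
    conjKernel (conjKernel κ F) G = conjKernel κ (F.trans G) := by
  ext x s hs
  rw [conjKernel_apply' _ _ _ hs, conjKernel_apply' _ _ _ (G.measurable hs),
    conjKernel_apply' _ _ _ hs]
  rfl

/-- Reporting is undone by the inverse transformation: the `V`-chain and the reported chain are
one Markov chain in two coordinate systems. -/
@[simp] theorem conjKernel_symm_conjKernel (κ : Kernel Ω Ω) (F : Ω ≃ᵐ Ω') :
    conjKernel (conjKernel κ F) F.symm = κ := by
  rw [conjKernel_conjKernel, MeasurableEquiv.self_trans_symm]
  ext x s hs
  rw [conjKernel_apply' _ _ _ hs]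
  rfl

/-! ## The observable dictionary (autocorrelations) -/

/-- **Stationary one-step correlations transfer.**  For an observable `O` of the reported chain,
`∫ O(x) · (∫ O d(conjKernel κ F x)) d(F_*ν)(x) = ∫ (O∘F)(v) · (∫ (O∘F) d(κ v)) dν(v)`: the lag-1
correlation of `O` under the reported chain started from `F_*ν` is that of `O ∘ F` under the
`V`-chain started from `ν`.  With `∫ O d(F_*ν) = ∫ O∘F dν` (`integral_map_equiv`) the
autocovariances, hence the integrated autocorrelation times, coincide. -/
theorem correlation_conjKernel (κ : Kernel Ω Ω) (F : Ω ≃ᵐ Ω') (ν : Measure Ω) (O : Ω' → ℝ) :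
    ∫ x, O x * (∫ y, O y ∂(conjKernel κ F x)) ∂(ν.map F) =
      ∫ v, O (F v) * (∫ w, O (F w) ∂(κ v)) ∂ν := by
  rw [integral_map_equiv]
  simp only [integral_conjKernel, MeasurableEquiv.symm_apply_apply]

/-- The same at every lag `n`: `∫ O · (Kⁿ O) d(F_*ν) = ∫ (O∘F) · (κⁿ (O∘F)) dν` with
`K = conjKernel κ F`. -/
theorem correlation_conjKernel_nHit (κ : Kernel Ω Ω) (F : Ω ≃ᵐ Ω') (ν : Measure Ω) (O : Ω' → ℝ)
    (n : ℕ) :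
    ∫ x, O x * (∫ y, O y ∂(nHit (conjKernel κ F) n x)) ∂(ν.map F) =
      ∫ v, O (F v) * (∫ w, O (F w) ∂(nHit κ n v)) ∂ν := by
  rw [← conjKernel_nHit]
  exact correlation_conjKernel _ _ _ _

/-! ## With an exact Jacobian: the transformed update targets the original weight -/

section Jacobian

variable {vol : Measure Ω} {F : Ω ≃ᵐ Ω} {J : Ω → ℝ≥0∞}

/-- **Field-transformed updates are exact.**  Let `F` have Jacobian `J` w.r.t. `vol`
(`HasJacobian`: `F_* (J · vol) = vol`) and let `κ` be ANY update leaving the pulled-back weight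
`((p ∘ F) · J) · vol` invariant.  Then `κ` reported through `F` leaves `p · vol` invariant — since
`F_* (((p ∘ F) · J) · vol) = p · vol` (`HasJacobian.map_withDensity`). -/
theorem transformedUpdate_invariant (hF : HasJacobian vol F J) {p : Ω → ℝ≥0∞} (hp : Measurable p)
    {κ : Kernel Ω Ω} (hκ : Invariant κ (vol.withDensity fun v => p (F v) * J v)) :
    Invariant (conjKernel κ F) (vol.withDensity p) := by
  have h := invariant_conjKernel hκ F
  rwa [hF.map_withDensity hp] at h

/-- The same for detailed balance: a `((p ∘ F) · J) · vol`-reversible update reported through `F`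
is `p · vol`-reversible. -/
theorem transformedUpdate_isReversible (hF : HasJacobian vol F J) {p : Ω → ℝ≥0∞}
    (hp : Measurable p) {κ : Kernel Ω Ω}
    (hκ : IsReversible κ (vol.withDensity fun v => p (F v) * J v)) :
    IsReversible (conjKernel κ F) (vol.withDensity p) := by
  have h := isReversible_conjKernel hκ F
  rwa [hF.map_withDensity hp] at h

/-- **Expectations transfer** (Lüscher's `⟨𝒪⟩ = ∫ D[V] 𝒪(𝓕(V)) e^{−S̃(V)}` up to normalisation):
`∫ O d(p · vol) = ∫ (O ∘ F) d(((p ∘ F) · J) · vol)` for every observable `O` — measuring `O ∘ F`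
on the `V`-ensemble IS measuring `O` on the target ensemble. -/
theorem integral_comp_transformed {E : Type*} [NormedAddCommGroup E] [NormedSpace ℝ E]
    (hF : HasJacobian vol F J) {p : Ω → ℝ≥0∞} (hp : Measurable p) (O : Ω → E) :
    ∫ v, O (F v) ∂(vol.withDensity fun v => p (F v) * J v) = ∫ u, O u ∂(vol.withDensity p) := by
  rw [← hF.map_withDensity hp, integral_map_equiv]

end Jacobian

/-! ## Lüscher's modified action and THMC -/

omit [MeasurableSpace Ω] [MeasurableSpace Ω'] in
/-- **The modified action.**  With `S̃ = S ∘ F − log J` (`J > 0` the Jacobian of `F`):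
`e^{−S̃(v)} = e^{−S(F v)} · J(v)` — the pulled-back Boltzmann weight IS a Boltzmann weight, so any
valid algorithm for the action `S̃` can be used on the `V`-variables. -/
theorem exp_neg_transformedAction {S : Ω' → ℝ} {F : Ω → Ω'} {J : Ω → ℝ} {v : Ω} (hJ : 0 < J v) :
    Real.exp (-(S (F v) - Real.log (J v))) = Real.exp (-S (F v)) * J v := by
  rw [neg_sub, Real.exp_sub, Real.exp_log hJ, Real.exp_neg, div_eq_mul_inv, mul_comm]

section THMC

variable {vol : Measure Ω} {F : Ω ≃ᵐ Ω} {J : Ω → ℝ}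

/-- The pulled-back Boltzmann weight written with the modified action:
`e^{−S̃} · vol = ((e^{−S} ∘ F) · J) · vol`. -/
theorem withDensity_exp_neg_transformedAction (hJ : ∀ v, 0 < J v) (S : Ω → ℝ) :
    (vol.withDensity fun v => ENNReal.ofReal (Real.exp (-(S (F v) - Real.log (J v))))) =
      vol.withDensity fun v =>
        ENNReal.ofReal (Real.exp (-S (F v))) * ENNReal.ofReal (J v) := by
  congr 1
  funext v
  rw [exp_neg_transformedAction (hJ v), ENNReal.ofReal_mul (Real.exp_pos _).le]

/-- **THMC is exact** (Lüscher 2010 §2.3; Engel–Schaefer 2011 §2, in kernel form).  Let the field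
transformation `F` have positive Jacobian `J` w.r.t. `vol` and let `κ` be any update of the
`V`-variables that leaves `e^{−S̃(V)} · vol` invariant, `S̃ = S ∘ F − log J` — e.g. an HMC
trajectory for `S̃` with accept/reject step (`InvolutiveMetropolis.involMH_invariant`), whatever
the integrator's accuracy.  Then the update reported in the variables `U = F V` leaves
`e^{−S(U)} · vol` invariant: measuring on `U = 𝓕(V)` along the `V`-chain samples the original
theory exactly, for EVERY bijective `F` with tractable Jacobian, trivializing or not. -/
theorem thmc_exact (hJ : ∀ v, 0 < J v) (hF : HasJacobian vol F fun v => ENNReal.ofReal (J v))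
    {S : Ω → ℝ} (hS : Measurable S) {κ : Kernel Ω Ω}
    (hκ : Invariant κ
      (vol.withDensity fun v => ENNReal.ofReal (Real.exp (-(S (F v) - Real.log (J v)))))) :
    Invariant (conjKernel κ F) (vol.withDensity fun u => ENNReal.ofReal (Real.exp (-S u))) := by
  rw [withDensity_exp_neg_transformedAction hJ S] at hκ
  exact transformedUpdate_invariant hF (p := fun u => ENNReal.ofReal (Real.exp (-S u)))
    (ENNReal.measurable_ofReal.comp (Real.measurable_exp.comp hS.neg)) hκ

/-- THMC inherits detailed balance: a `e^{−S̃} · vol`-reversible update reported through `F` is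
`e^{−S} · vol`-reversible. -/
theorem thmc_isReversible (hJ : ∀ v, 0 < J v)
    (hF : HasJacobian vol F fun v => ENNReal.ofReal (J v)) {S : Ω → ℝ} (hS : Measurable S)
    {κ : Kernel Ω Ω}
    (hκ : IsReversible κ
      (vol.withDensity fun v => ENNReal.ofReal (Real.exp (-(S (F v) - Real.log (J v)))))) :
    IsReversible (conjKernel κ F)
      (vol.withDensity fun u => ENNReal.ofReal (Real.exp (-S u))) := by
  rw [withDensity_exp_neg_transformedAction hJ S] at hκ
  exact transformedUpdate_isReversible hF (p := fun u => ENNReal.ofReal (Real.exp (-S u)))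
    (ENNReal.measurable_ofReal.comp (Real.measurable_exp.comp hS.neg)) hκ

end THMC

/-- **THMC is exact for the normalised law** `𝒵⁻¹ e^{−S} · vol` (any scalar multiple of the
weight), under the hypotheses of `thmc_exact` — invariance is homogeneous in the measure
(`invariant_smul` of `RefreshScan.lean`); the partition function is never needed. -/
theorem thmc_exact_smul {vol : Measure Ω} {F : Ω ≃ᵐ Ω} {J : Ω → ℝ} (hJ : ∀ v, 0 < J v)
    (hF : HasJacobian vol F fun v => ENNReal.ofReal (J v)) {S : Ω → ℝ} (hS : Measurable S)
    {κ : Kernel Ω Ω}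
    (hκ : Invariant κ
      (vol.withDensity fun v => ENNReal.ofReal (Real.exp (-(S (F v) - Real.log (J v))))))
    (c : ℝ≥0∞) :
    Invariant (conjKernel κ F) (c • vol.withDensity fun u => ENNReal.ofReal (Real.exp (-S u))) :=
  invariant_smul (thmc_exact hJ hF hS hκ) c

/-! ## Lattice gauge theory: the Wilson weight as target -/

section Wilson

open Literature.MathematicalPhysics.QuantumFieldTheory

variable {d L N : ℕ} [NeZero L] {G : Type*} [Group G] [TopologicalSpace G] [IsTopologicalGroup G]
  [CompactSpace G] [MeasurableSpace G] [BorelSpace G] (ρ : G →* Matrix (Fin N) (Fin N) ℂ)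

/-- **Field-transformed updates are exact for lattice gauge fields.**  On `Ω = G^E`
(`GaugeConfig d L G`, `G` compact) with the product Haar reference measure, let the field
transformation `F` (a trivializing map, a trained flow, any measurable bijection) have Jacobian
`J`, and let `κ` be any update of the `V`-variables leaving the pulled-back Wilson weight
`(e^{−β S_W} ∘ F) · J · ⊗_e dV_e` invariant.  Then `κ` reported through `F` leaves the tree's
un-normalised Wilson weight `wilsonWeight ρ β = e^{−β S_W(U)} ⊗_e dU_e` invariant (measurability
of the Wilson action is the only regularity used; it holds for continuous `ρ`). -/
theorem thmc_wilson_exact (β : ℝ) {F : GaugeConfig d L G ≃ᵐ GaugeConfig d L G}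
    {J : GaugeConfig d L G → ℝ≥0∞}
    (hF : HasJacobian (Measure.pi fun _ : Edge d L => haarProbability G) F J)
    (hS : Measurable (wilsonAction (d := d) (L := L) ρ)) {κ : Kernel (GaugeConfig d L G) (GaugeConfig d L G)}
    (hκ : Invariant κ ((Measure.pi fun _ : Edge d L => haarProbability G).withDensity
      fun V => ENNReal.ofReal (Real.exp (-β * wilsonAction ρ (F V))) * J V)) :
    Invariant (conjKernel κ F) (wilsonWeight ρ β) :=
  transformedUpdate_invariant hF
    (p := fun U => ENNReal.ofReal (Real.exp (-β * wilsonAction ρ U)))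
    (ENNReal.measurable_ofReal.comp (Real.measurable_exp.comp (hS.const_mul (-β)))) hκ

end Wilson

end Summit.Ventures.LatticeQCDFlow.Exactness
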